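import Summits.QuantumFields.GaugeBoot.GaugeInvariantBootstrapConvergence
import HarnessLib

/-!
# The bootstrap constraints indexed by monomials — multi-index open-string operators (gauge-boot, L1 supplement)

HONEST FRAMING (cell `pub-gaugeboot`, page 1 of every file): the venture produces certified bounds
on lattice expectations at stated coupling, gauge group, dimension and torus size; NOT a mass gap,
NOT a continuum limit, NOT a string tension; NOT Yang–Mills-summit-bearing (barriers
`FixedCouplingUltralocality`, `PerturbativeInvisibility`). Structural; it certifies no number.

## Content

The dictionary between the tree's untruncated bootstrap (`BootstrapFunctionals`,
`GaugeInvariantBootstrap`: constraints for ALL polynomial test functions) and the data a finite-`N`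
lattice bootstrap actually enumerates (Kazakov–Zheng 2024 §2.3, §3.1: multi-index operators
`O_{1,a₁b₁} ⋯ O_{m,a_m b_m}` built from link variables). The polynomial observables are the linear
span of the MONOMIALS — finite products of the generators `Re/Im ρ(U_e)_{ab}`, i.e. (real and
imaginary parts of) products of matrix entries of link variables, the multi-index open-string
operators (`polyAlgebra_toSubmodule_eq_span`). Since the constraints are linear (rows) or quadratic
(positivity) in the test function:

* ★ `isSDFunctional_iff_monomials` — the loop equations for all polynomial test functions ⇔ the
  loop equations for all MONOMIAL test functions (rows are linear: `row_of_rows_span`);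
* ★ `sqPositive_iff_posSemidef_monomials` — square-positivity on all polynomials ⇔ positive
  semi-definiteness of the moment matrix `(φ (m_i m_j))_{ij}` of every finite family of monomials;
* ★★ `isBootstrapFeasible_comp_poly_iff_monomials` — hence the untruncated bootstrap on
  gauge-invariant data (`ψ ∘ₗ A`, `A` the gauge average) is: `ψ 1 = 1`, PSD of every matrix
  `(ψ (A (m_i m_j)))_{ij}` of gauge-averaged products of monomials (for single Wilson-line entries
  these are the loop Gram matrices of `WilsonLineGramPositivity`), and the gauge-averaged loop
  equation of every monomial test function (multi-trace Makeenko–Migdal rows);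
  `gaugeInvariantBootstrap_iff_monomials_suN` — the `SU(N)` torus instance, whose solutions are
  exactly the Wilson expectation (`comp_gaugeAvgL_eq_wilson_suN`).

What this is NOT: an evaluation of `A (m_i m_j)` / `A m'` beyond single lines (Weingarten); no
reduction to single-trace unknowns.

References: V. Kazakov, Z. Zheng, arXiv:2404.16925 §2.3, §3.1 (3.4); P. Anderson, M. Kruczenski,
Nucl. Phys. B 921 (2017) §3. Folklore.
-/

noncomputable section

open MeasureTheory Filter Topology NormedSpace
open Literature.MathematicalPhysics.QuantumFieldTheory (haarProbability LatticeRep)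

namespace Summit.QuantumFields.GaugeBoot

section General

variable {ι : Type*} [DecidableEq ι] [Countable ι] {G : Type*} [Group G] [TopologicalSpace G]
  [IsTopologicalGroup G] [CompactSpace G] [MeasurableSpace G] [BorelSpace G]
  [SecondCountableTopology G] (r : LatticeRep G) {K : Type*} {k : K → ℝ → G}
  {X : K → Matrix (Fin r.N) (Fin r.N) ℂ} {S : ι → (ι → G) → ℝ} {β : ℝ}

omit [DecidableEq ι] [Countable ι] [IsTopologicalGroup G] [CompactSpace G] [MeasurableSpace G]
  [BorelSpace G] [SecondCountableTopology G] in
/-- **The polynomial observables are the linear span of the monomials** (finite products of the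
generators `Re/Im ρ(U_e)_{ab}`: multi-index open-string operators). -/
theorem polyAlgebra_toSubmodule_eq_span :
    Subalgebra.toSubmodule (polyAlgebra (ι := ι) r) =
      Submodule.span ℝ (Submonoid.closure (entryGens (ι := ι) r) : Set C(ι → G, ℝ)) :=
  Algebra.adjoin_eq_span ℝ (entryGens (ι := ι) r)

omit [DecidableEq ι] [Countable ι] [IsTopologicalGroup G] [CompactSpace G] [MeasurableSpace G]
  [BorelSpace G] [SecondCountableTopology G] in
/-- Every polynomial observable is a finite linear combination of monomials. -/
theorem exists_sum_monomials_of_mem_polyAlgebra {a : C(ι → G, ℝ)} (ha : a ∈ polyAlgebra (ι := ι) r) :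
    ∃ (n : ℕ) (c : Fin n → ℝ) (m : Fin n → C(ι → G, ℝ)),
      (∀ j, m j ∈ Submonoid.closure (entryGens (ι := ι) r)) ∧ ∑ j, c j • m j = a := by
  have ha' : a ∈ Submodule.span ℝ (Submonoid.closure (entryGens (ι := ι) r) : Set C(ι → G, ℝ)) := by
    rw [← polyAlgebra_toSubmodule_eq_span]; exact ha
  obtain ⟨n, c, g, hsum⟩ := Submodule.mem_span_set'.1 ha'
  exact ⟨n, c, fun j => (g j : C(ι → G, ℝ)), fun j => (g j).2, hsum⟩

omit [Countable ι] [CompactSpace G] [MeasurableSpace G] [BorelSpace G] [SecondCountableTopology G] in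
/-- ★ **Rows for monomials suffice**: a linear functional satisfies the loop equations for all
polynomial test functions iff it satisfies them for all MONOMIAL test functions (with the same
polynomial derivatives of the local actions). [folklore] -/
theorem isSDFunctional_iff_monomials (hk : ∀ a s t, k a (s + t) = k a s * k a t)
    (hX : ∀ a t, r.ρ (k a t) = exp ((t : ℂ) • X a)) (φ : C(ι → G, ℝ) →ₗ[ℝ] ℝ) :
    IsSDFunctional r k S β φ ↔
      ∀ (i : ι) (a : K), ∃ S' ∈ polyAlgebra (ι := ι) r,
        (∀ U, HasDerivAt (fun t => S i (Function.update U i (k a t * U i))) (S' U) 0) ∧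
          ∀ m ∈ Submonoid.closure (entryGens (ι := ι) r), ∀ m' ∈ polyAlgebra (ι := ι) r,
            (∀ U, HasDerivAt (fun t => m (Function.update U i (k a t * U i))) (m' U) 0) →
              φ m' = β * φ (m * S') := by
  refine forall_congr' fun i => forall_congr' fun a => ⟨?_, ?_⟩
  · rintro ⟨S', hS'm, hS', hrows⟩
    exact ⟨S', hS'm, hS', fun m hm => hrows m (mem_polyAlgebra_of_mem_closure r hm)⟩
  · rintro ⟨S', hS'm, hS', hrows⟩
    refine ⟨S', hS'm, hS', fun f hf f' _ hf' => ?_⟩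
    obtain ⟨n, c, m, hm, rfl⟩ := exists_sum_monomials_of_mem_polyAlgebra r hf
    have hmem : ∑ j, c j • m j ∈ Submodule.span ℝ (Set.range m) :=
      Submodule.sum_mem _ fun j _ => Submodule.smul_mem _ _ (Submodule.subset_span ⟨j, rfl⟩)
    exact row_of_rows_span r hk hX (fun j => mem_polyAlgebra_of_mem_closure r (hm j)) i a S'
      (fun j => hrows (m j) (hm j)) hmem hf'

omit [DecidableEq ι] [Countable ι] [IsTopologicalGroup G] [CompactSpace G] [MeasurableSpace G]
  [BorelSpace G] [SecondCountableTopology G] in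
/-- ★ **Positivity = PSD moment matrices of monomials**: a linear functional is square-positive on
the polynomial observables iff the moment matrix `(φ (m_i m_j))_{ij}` of every finite family of
monomials is positive semi-definite (Kazakov–Zheng's Hermitian-conjugation positivity (3.4) for all
multi-index operators). [folklore] -/
theorem sqPositive_iff_posSemidef_monomials (φ : C(ι → G, ℝ) →ₗ[ℝ] ℝ) :
    (∀ a ∈ polyAlgebra (ι := ι) r, 0 ≤ φ (a * a)) ↔
      ∀ (n : ℕ) (m : Fin n → C(ι → G, ℝ)), (∀ j, m j ∈ Submonoid.closure (entryGens (ι := ι) r)) →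
        (momentMatrix φ m).PosSemidef := by
  constructor
  · intro h n m hm
    refine (sqPositive_span_iff_posSemidef φ m).1 fun a ha => h a ?_
    have hle : Submodule.span ℝ (Set.range m) ≤ Subalgebra.toSubmodule (polyAlgebra (ι := ι) r) :=
      Submodule.span_le.2 (by rintro _ ⟨j, rfl⟩; exact mem_polyAlgebra_of_mem_closure r (hm j))
    exact hle ha
  · intro h a ha
    obtain ⟨n, c, m, hm, rfl⟩ := exists_sum_monomials_of_mem_polyAlgebra r ha
    have hmem : ∑ j, c j • m j ∈ Submodule.span ℝ (Set.range m) :=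
      Submodule.sum_mem _ fun j _ => Submodule.smul_mem _ _ (Submodule.subset_span ⟨j, rfl⟩)
    exact (sqPositive_span_iff_posSemidef φ m).2 (h n m hm) _ hmem

omit [Countable ι] [CompactSpace G] [MeasurableSpace G] [BorelSpace G] [SecondCountableTopology G] in
/-- ★★ **The untruncated bootstrap written on monomial data**, for a functional of the form `ψ ∘ₗ A`
(`A` any linear self-map of the observables with `A 1 = 1`; `A` = the gauge average gives the
bootstrap on gauge-invariant data): `ψ 1 = 1`; for every finite family of monomials `m_j` the matrix
`(ψ (A (m_i m_j)))_{ij}` is positive semi-definite; and for every monomial test function `m` the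
averaged loop equation `ψ (A m') = β ψ (A (m S_i'))`. [folklore] -/
theorem isBootstrapFeasible_comp_poly_iff_monomials (hk : ∀ a s t, k a (s + t) = k a s * k a t)
    (hX : ∀ a t, r.ρ (k a t) = exp ((t : ℂ) • X a)) (A : C(ι → G, ℝ) →ₗ[ℝ] C(ι → G, ℝ))
    (hA : A 1 = 1) (ψ : C(ι → G, ℝ) →ₗ[ℝ] ℝ) :
    IsBootstrapFeasible r k S β (polyAlgebra (ι := ι) r : Set C(ι → G, ℝ)) (ψ ∘ₗ A) ↔
      ψ 1 = 1 ∧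
        (∀ (n : ℕ) (m : Fin n → C(ι → G, ℝ)), (∀ j, m j ∈ Submonoid.closure (entryGens (ι := ι) r)) →
          (Matrix.of fun i j => ψ (A (m i * m j))).PosSemidef) ∧
        ∀ (i : ι) (a : K), ∃ S' ∈ polyAlgebra (ι := ι) r,
          (∀ U, HasDerivAt (fun t => S i (Function.update U i (k a t * U i))) (S' U) 0) ∧
            ∀ m ∈ Submonoid.closure (entryGens (ι := ι) r), ∀ m' ∈ polyAlgebra (ι := ι) r,
              (∀ U, HasDerivAt (fun t => m (Function.update U i (k a t * U i))) (m' U) 0) →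
                ψ (A m') = β * ψ (A (m * S')) := by
  rw [isBootstrapFeasible_poly_iff, sqPositive_iff_posSemidef_monomials, isSDFunctional_iff_monomials r hk hX,
    LinearMap.comp_apply, hA]
  rfl

end General

/-! ## `SU(N)` on the torus -/

section Unitary

open Literature.MathematicalPhysics.QuantumFieldTheory (Edge GaugeConfig wilsonAction wilsonMeasure)
open Literature.MathematicalPhysics.QuantumLattice

variable {d L : ℕ}

/-- ★★ **`SU(N)` on `(ℤ/L)^d`: the untruncated bootstrap on gauge-invariant data in monomial form
— `ψ 1 = 1`, positive semi-definiteness of every matrix of gauge-averaged products of multi-index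
open-string operators, and the gauge-averaged loop equation of every such operator — and (by
`comp_gaugeAvgL_eq_wilson_suN`) its solutions give every gauge-invariant polynomial its Wilson
expectation.** [folklore] -/
theorem gaugeInvariantBootstrap_iff_monomials_suN [NeZero L] (N : ℕ) (β : ℝ)
    (ψ : C(GaugeConfig d L (Matrix.specialUnitaryGroup (Fin N) ℂ), ℝ) →ₗ[ℝ] ℝ) :
    IsBootstrapFeasible (fundamentalLatticeRep N) (suExp N) (fun _ => wilsonAction (fundamentalRep (Fin N))) β
        (polyAlgebra (ι := Edge d L) (fundamentalLatticeRep N) : Set _) (ψ ∘ₗ gaugeAvgL d L _) ↔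
      ψ 1 = 1 ∧
        (∀ (n : ℕ) (m : Fin n → C(GaugeConfig d L (Matrix.specialUnitaryGroup (Fin N) ℂ), ℝ)),
          (∀ j, m j ∈ Submonoid.closure (entryGens (ι := Edge d L) (fundamentalLatticeRep N))) →
            (Matrix.of fun i j => ψ (gaugeAvgL d L _ (m i * m j))).PosSemidef) ∧
        ∀ (e : Edge d L) (Y : SuGenerator N),
          ∃ S' ∈ polyAlgebra (ι := Edge d L) (fundamentalLatticeRep N),
            (∀ U, HasDerivAt (fun t => wilsonAction (d := d) (L := L) (fundamentalRep (Fin N))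
              (Function.update U e (suExp N Y t * U e))) (S' U) 0) ∧
              ∀ m ∈ Submonoid.closure (entryGens (ι := Edge d L) (fundamentalLatticeRep N)),
                ∀ m' ∈ polyAlgebra (ι := Edge d L) (fundamentalLatticeRep N),
                  (∀ U, HasDerivAt (fun t => m (Function.update U e (suExp N Y t * U e))) (m' U) 0) →
                    ψ (gaugeAvgL d L _ m') = β * ψ (gaugeAvgL d L _ (m * S')) :=
  isBootstrapFeasible_comp_poly_iff_monomials (fundamentalLatticeRep N) (suExp_add N)
    (X := fun X : SuGenerator N => (X : Matrix (Fin N) (Fin N) ℂ)) (rho_suExp N) _ (gaugeAvgL_one) ψ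

/-- **…and every solution of the monomial-form constraints is the Wilson expectation on the
gauge-invariant polynomials** (`SU(N)`, torus, any real `β`). [folklore] -/
theorem eq_wilson_of_monomialBootstrap_suN [NeZero L] (N : ℕ) (β : ℝ)
    {ψ : C(GaugeConfig d L (Matrix.specialUnitaryGroup (Fin N) ℂ), ℝ) →ₗ[ℝ] ℝ}
    (hψ : IsBootstrapFeasible (fundamentalLatticeRep N) (suExp N) (fun _ => wilsonAction (fundamentalRep (Fin N)))
      β (polyAlgebra (ι := Edge d L) (fundamentalLatticeRep N) : Set _) (ψ ∘ₗ gaugeAvgL d L _))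
    {a : C(GaugeConfig d L (Matrix.specialUnitaryGroup (Fin N) ℂ), ℝ)}
    (ha : a ∈ polyAlgebra (ι := Edge d L) (fundamentalLatticeRep N))
    (hai : Literature.MathematicalPhysics.QuantumFieldTheory.IsGaugeInvariant (⇑a)) :
    ψ a = ∫ U, a U ∂(wilsonMeasure (fundamentalRep (Fin N)) β) := by
  have h1 : ψ 1 = 1 := by
    have h := hψ.1
    rwa [LinearMap.comp_apply, gaugeAvgL_one] at h
  exact eq_wilson_of_gaugeInvariantBootstrap_suN N β h1 hψ.2.1 hψ.2.2 ha hai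

end Unitary

end Summit.QuantumFields.GaugeBoot

end
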